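import Mathlib
import Literature.Probability.Percolation.Percolation
import Literature.Probability.Percolation.SharpnessDCTProofs
import Literature.Probability.Percolation.DiagonalStripColumns
import Literature.Probability.Percolation.DiagonalColumnPatterns
import Literature.Probability.Percolation.DiagonalStripJunction
import Literature.Probability.Percolation.DiagonalStripTransferLaw
import HarnessLib

/-!
# Doeblin contraction and two-column periodicity of the diagonal-strip transfer matrix

Topic `Literature/Probability/Percolation`. Dictionary step (i) of the named fact
`Literature.Probability.Percolation.IkhlefPonsaingFirstPassage` (Ikhlef–Ponsaing, J. Stat. Phys.
149 (2012), arXiv:1202.5476), law side, for the stochastic transfer matrix `T_c = ipTransfer m c`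
of `DiagonalStripTransferLaw.lean`. IP12 §3.1 and §3.4: "we take an arbitrary initial state
`|in⟩` and act `N` times with the transfer matrix … as `N → ∞` we get `Λ^N |Ψ⟩` … the ground state
is unique". In the percolation (`n = 1`) case this is a finite Markov chain, and we prove the
quantitative version:

* `colUpdate_false`, `ipTransfer_reset_ge` — **Doeblin's minorisation**: an all-closed layer
  (probability `≥ ε_m = 2^{-(m+1)²}`) resets every pattern to the bare-column pattern
  `colInit m (c+1)`;
* `pushLaw`, `pushIter` (the action `μ ↦ μ T_c` and its iterates; `iterLaw_eq_pushIter`,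
  `pushIter_succ_left`, `sum_pushLaw`), the `ℓ¹` size `l1`, and **`l1_pushLaw_le`**: a signed
  vector of mass `0` is contracted by `1 - ε_m`; `l1_pushIter_sub_le`; `dist_le_l1`, `l1_sub_le_two`;
* **two-column periodicity** from translation invariance of `P_{1/2}` along the strip
  (`bondPercolation_real_preimage_shift`): `iterLaw_add_two_mul`, `ipTransfer_add_two_mul`,
  `pushLaw_add_two_mul` (`T_{c+2} = T_c`).

The limit (stationary law, the infinite-strip passage probability as a stationary pairing, and
the reduction of the named fact to the `q`KZ identity) is `DiagonalStripStationary.lean`.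

## References

* Y. Ikhlef, A. K. Ponsaing, J. Stat. Phys. 149 (2012) 10–36, arXiv:1202.5476, §3.1, §3.4.
  [IkhlefPonsaing2012]
* W. Doeblin's condition / coupling for finite Markov chains: e.g. Grimmett–Stirzaker,
  *Probability and Random Processes*, §6.4 (folklore here; proved from scratch).
-/

namespace Literature.Probability.Percolation

open Literature.Probability.LatticeModels

/-! ### The reset: an all-closed layer forgets the pattern -/

section Reset

variable {m : ℕ}

/-- With no cross edges, the closure of `updRel` does not move a new site. [folklore] -/
theorem eqvGen_updRel_false_inr {P : ColPattern m} {j : Fin (m + 1)} {z : Fin (m + 1) ⊕ Fin (m + 1)}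
    (h : Relation.EqvGen (updRel m P (fun _ _ => false)) (Sum.inr j) z) : z = Sum.inr j := by
  suffices H : ∀ a b, Relation.EqvGen (updRel m P (fun _ _ => false)) a b → (a = Sum.inr j ↔ b = Sum.inr j) from
    ((H _ _ h).1 rfl).symm ▸ rfl
  intro a b hab
  induction hab with
  | rel a b hr =>
    rcases a with i | i <;> rcases b with i' | i' <;> simp [updRel] at hr ⊢
  | refl a => exact Iff.rfl
  | symm a b _ ih => exact ih.symm
  | trans a b c _ _ ih₁ ih₂ => exact ih₁.trans ih₂

/-- **An all-closed layer resets the pattern** to the bare-column pattern of the new column,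
whatever the old pattern. [cite: IkhlefPonsaing2012, §3.1] -/
theorem colUpdate_false (c : ℤ) (P : ColPattern m) :
    colUpdate m c P (fun _ _ => false) = colInit m (c + 1) := by
  classical
  refine Prod.ext (funext fun j => funext fun j' => ?_) (funext fun j => ?_)
  · simp only [colUpdate, colInit]
    rw [decide_eq_decide]
    constructor
    · intro h
      exact Sum.inr_injective (eqvGen_updRel_false_inr h).symm
    · rintro rfl
      exact Relation.EqvGen.refl _
  · simp only [colUpdate, colInit]
    rw [decide_eq_decide]
    constructor
    · rintro ⟨z, hz, hw⟩
      rw [eqvGen_updRel_false_inr hz] at hw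
      exact hw
    · intro h
      exact ⟨Sum.inr j, Relation.EqvGen.refl _, h⟩

/-- On the event "all pairs of the layer `c` are closed" the edge layer is identically `false`. [folklore] -/
theorem colEdges_eq_false_of_forall_notMem {ω : BondConfig (Site 2)} {c : ℤ}
    (h : ∀ e ∈ layerPairs m c, e ∉ ω) : colEdges ω m c = fun _ _ => false := by
  classical
  funext i j
  simp only [colEdges, decide_eq_false_iff_not]
  exact h _ (mk_mem_layerPairs m c i j)

open MeasureTheory

/-- A single pair is closed with probability at least `1/2` under `P_{1/2}` (exactly `1/2` for a
lattice edge, `1` for a non-edge). [folklore] -/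
theorem half_le_real_notMem (e : Sym2 (Site 2)) :
    (1 / 2 : ℝ) ≤ (bondPercolation (zdGraph 2) half).real {ω | e ∉ ω} := by
  by_cases he : e ∈ (zdGraph 2).edgeSet
  · rw [DCT16.real_notMem (zdGraph 2) half he, coe_half]
    norm_num
  · have : (bondPercolation (zdGraph 2) half).real {ω | e ∉ ω} = (bondPercolation (zdGraph 2) half).real Set.univ :=
      DCT16.real_congr_of_forall_subset_edgeSet (zdGraph 2) half fun ω hω =>
        ⟨fun _ => Set.mem_univ _, fun _ h => he (hω h)⟩
    rw [this, probReal_univ]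
    norm_num

/-- All pairs of a finite set are closed with probability at least `2^{-|F|}`. [folklore] -/
theorem pow_le_real_forall_notMem (F : Finset (Sym2 (Site 2))) :
    (1 / 2 : ℝ) ^ F.card ≤ (bondPercolation (zdGraph 2) half).real {ω | ∀ e ∈ F, e ∉ ω} := by
  classical
  induction F using Finset.induction_on with
  | empty => simp
  | @insert e F heF ih =>
    have hset : {ω : BondConfig (Site 2) | ∀ e' ∈ insert e F, e' ∉ ω} =
        {ω | e ∉ ω} ∩ {ω | ∀ e' ∈ F, e' ∉ ω} := by
      ext ω; simp
    have hA : DeterminedBy {ω : BondConfig (Site 2) | e ∉ ω} ↑({e} : Finset (Sym2 (Site 2))) := by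
      rw [determinedBy_iff]
      intro ω ω' h
      have := forall_mem_iff_of_inter_eq h e (Finset.mem_singleton_self e)
      simp only [Set.mem_setOf_eq]
      exact not_congr this
    have hB : DeterminedBy {ω : BondConfig (Site 2) | ∀ e' ∈ F, e' ∉ ω} ↑F := by
      rw [determinedBy_iff]
      intro ω ω' h
      simp only [Set.mem_setOf_eq]
      exact forall₂_congr fun e' he' => not_congr (forall_mem_iff_of_inter_eq h e' he')
    rw [hset, DCT16.real_inter_of_determinedBy_disjoint (zdGraph 2) half hA hB
      (Finset.disjoint_singleton_left.2 heF), Finset.card_insert_of_notMem heF, pow_succ']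
    exact mul_le_mul (half_le_real_notMem e) ih (by positivity) measureReal_nonneg

/-- **Doeblin's minorisation for the strip**: from every pattern, one layer leads to the reset
pattern `colInit m (c+1)` with probability at least `ε_m = 2^{-(m+1)²}` (an all-closed layer).
[cite: IkhlefPonsaing2012, §3.1] -/
theorem ipTransfer_reset_ge (c : ℤ) (P : ColPattern m) :
    (1 / 2 : ℝ) ^ ((m + 1) * (m + 1)) ≤ ipTransfer m c P (colInit m (c + 1)) := by
  classical
  have hcard : (layerPairs m c).card ≤ (m + 1) * (m + 1) := by
    refine (Finset.card_image_le).trans ?_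
    simp
  calc (1 / 2 : ℝ) ^ ((m + 1) * (m + 1)) ≤ (1 / 2 : ℝ) ^ (layerPairs m c).card :=
        pow_le_pow_of_le_one (by norm_num) (by norm_num) hcard
    _ ≤ (bondPercolation (zdGraph 2) half).real {ω | ∀ e ∈ layerPairs m c, e ∉ ω} :=
        pow_le_real_forall_notMem _
    _ ≤ ipTransfer m c P (colInit m (c + 1)) := by
        unfold ipTransfer
        refine measureReal_mono (fun ω hω => ?_)
        simp only [Set.mem_setOf_eq] at hω ⊢
        rw [colEdges_eq_false_of_forall_notMem hω, colUpdate_false]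

end Reset

/-! ### Contraction of the transfer step in `ℓ¹` -/

section Contraction

variable {m : ℕ}

/-- One step of the law: `(μ T_c)(P') = ∑_P μ(P) T_c(P, P')`. [cite: IkhlefPonsaing2012, §3.1] -/
noncomputable def pushLaw (m : ℕ) (c : ℤ) (μ : ColPattern m → ℝ) : ColPattern m → ℝ :=
  fun P' => ∑ P : ColPattern m, μ P * ipTransfer m c P P'

/-- `n` steps of the law from column `a`: `μ T_a T_{a+1} ⋯ T_{a+n-1}`. [cite: IkhlefPonsaing2012, §3.1] -/
noncomputable def pushIter (m : ℕ) (a : ℤ) (μ : ColPattern m → ℝ) : ℕ → ColPattern m → ℝ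
  | 0 => μ
  | n + 1 => pushLaw m (a + n) (pushIter m a μ n)

/-- The iterated law is the iterated push of the initial law. [cite: IkhlefPonsaing2012, §3.1] -/
theorem iterLaw_eq_pushIter (a : ℤ) (n : ℕ) : iterLaw m a n = pushIter m a (iterLaw m a 0) n := by
  induction n with
  | zero => rfl
  | succ n ih =>
    funext P'
    rw [iterLaw_succ, pushIter, ← ih]
    rfl

/-- Re-indexing: `n + 1` steps from `a` are one step at `a` followed by `n` steps from `a + 1`. [folklore] -/
theorem pushIter_succ_left (a : ℤ) (μ : ColPattern m → ℝ) (n : ℕ) :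
    pushIter m a μ (n + 1) = pushIter m (a + 1) (pushLaw m a μ) n := by
  induction n with
  | zero => simp [pushIter]
  | succ n ih =>
    rw [pushIter, ih, pushIter, show a + ((n + 1 : ℕ) : ℤ) = a + 1 + n by push_cast; ring]

/-- The push preserves total mass. [folklore] -/
theorem sum_pushLaw (c : ℤ) (μ : ColPattern m → ℝ) : ∑ P', pushLaw m c μ P' = ∑ P, μ P := by
  unfold pushLaw
  rw [Finset.sum_comm]
  refine Finset.sum_congr rfl fun P _ => ?_
  rw [← Finset.mul_sum, sum_ipTransfer, mul_one]

/-- The push is linear: difference. [folklore] -/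
theorem pushLaw_sub (c : ℤ) (μ ν : ColPattern m → ℝ) :
    pushLaw m c μ - pushLaw m c ν = pushLaw m c (μ - ν) := by
  funext P'
  simp only [Pi.sub_apply, pushLaw, ← Finset.sum_sub_distrib, sub_mul]

/-- The `ℓ¹` size of a vector on patterns. [folklore] -/
noncomputable def l1 (x : ColPattern m → ℝ) : ℝ := ∑ P, |x P|

/-- **Doeblin contraction**: a signed vector of total mass `0` is contracted by the factor
`1 - ε_m` under one transfer step. [folklore] -/
theorem l1_pushLaw_le (c : ℤ) (x : ColPattern m → ℝ) (hx : ∑ P, x P = 0) :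
    l1 (pushLaw m c x) ≤ (1 - (1 / 2 : ℝ) ^ ((m + 1) * (m + 1))) * l1 x := by
  classical
  set ε := (1 / 2 : ℝ) ^ ((m + 1) * (m + 1)) with hε
  set Q := colInit m (c + 1) with hQ
  -- subtract `ε δ_Q` from the `Q`-column: the remainder is nonnegative with row sums `1 - ε`
  have hrow : ∀ P, ∑ P', (ipTransfer m c P P' - if P' = Q then ε else 0) = 1 - ε := by
    intro P
    rw [Finset.sum_sub_distrib, sum_ipTransfer, Finset.sum_ite_eq' Finset.univ Q (fun _ => ε)]
    simp
  have hnn : ∀ P P', 0 ≤ ipTransfer m c P P' - (if P' = Q then ε else 0) := by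
    intro P P'
    split_ifs with h
    · rw [h]; exact sub_nonneg.2 (ipTransfer_reset_ge c P)
    · rw [sub_zero]; exact ipTransfer_nonneg c P P'
  have hpush : ∀ P', pushLaw m c x P' = ∑ P, x P * (ipTransfer m c P P' - if P' = Q then ε else 0) := by
    intro P'
    unfold pushLaw
    rw [← sub_eq_zero, ← Finset.sum_sub_distrib]
    have : ∀ P, x P * ipTransfer m c P P' - x P * (ipTransfer m c P P' - if P' = Q then ε else 0) =
        x P * (if P' = Q then ε else 0) := fun P => by ring
    rw [Finset.sum_congr rfl fun P _ => this P, ← Finset.sum_mul, hx, zero_mul]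
  calc l1 (pushLaw m c x) = ∑ P', |∑ P, x P * (ipTransfer m c P P' - if P' = Q then ε else 0)| := by
        unfold l1; exact Finset.sum_congr rfl fun P' _ => by rw [hpush]
    _ ≤ ∑ P', ∑ P, |x P| * (ipTransfer m c P P' - if P' = Q then ε else 0) := by
        refine Finset.sum_le_sum fun P' _ => (Finset.abs_sum_le_sum_abs _ _).trans (le_of_eq ?_)
        exact Finset.sum_congr rfl fun P _ => by rw [abs_mul, abs_of_nonneg (hnn P P')]
    _ = ∑ P, |x P| * (1 - ε) := by
        rw [Finset.sum_comm]
        exact Finset.sum_congr rfl fun P _ => by rw [← Finset.mul_sum, hrow]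
    _ = (1 - ε) * l1 x := by rw [← Finset.sum_mul, mul_comm]; rfl

/-- Iterated contraction between two laws of equal mass. [folklore] -/
theorem l1_pushIter_sub_le (a : ℤ) (μ ν : ColPattern m → ℝ) (h : ∑ P, μ P = ∑ P, ν P) (n : ℕ) :
    l1 (pushIter m a μ n - pushIter m a ν n) ≤ (1 - (1 / 2 : ℝ) ^ ((m + 1) * (m + 1))) ^ n * l1 (μ - ν) := by
  induction n with
  | zero => simp [pushIter]
  | succ n ih =>
    have hmass : ∀ k, ∑ P, pushIter m a μ k P = ∑ P, pushIter m a ν k P := by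
      intro k
      induction k with
      | zero => exact h
      | succ k ihk => simp only [pushIter, sum_pushLaw, ihk]
    have hz : ∑ P, (pushIter m a μ n - pushIter m a ν n) P = 0 := by
      simp only [Pi.sub_apply, Finset.sum_sub_distrib, hmass n, sub_self]
    calc l1 (pushIter m a μ (n + 1) - pushIter m a ν (n + 1))
        = l1 (pushLaw m (a + n) (pushIter m a μ n - pushIter m a ν n)) := by
          simp only [pushIter, pushLaw_sub]
      _ ≤ (1 - (1 / 2 : ℝ) ^ ((m + 1) * (m + 1))) * l1 (pushIter m a μ n - pushIter m a ν n) :=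
          l1_pushLaw_le _ _ hz
      _ ≤ (1 - (1 / 2 : ℝ) ^ ((m + 1) * (m + 1))) *
            ((1 - (1 / 2 : ℝ) ^ ((m + 1) * (m + 1))) ^ n * l1 (μ - ν)) :=
          mul_le_mul_of_nonneg_left ih (sub_nonneg.2 (pow_le_one₀ (by norm_num) (by norm_num)))
      _ = _ := by ring

/-- The `ℓ¹` distance of two probability vectors is at most `2`. [folklore] -/
theorem l1_sub_le_two {μ ν : ColPattern m → ℝ} (hμ : ∀ P, 0 ≤ μ P) (hν : ∀ P, 0 ≤ ν P)
    (hμ1 : ∑ P, μ P = 1) (hν1 : ∑ P, ν P = 1) : l1 (μ - ν) ≤ 2 := by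
  unfold l1
  calc ∑ P, |(μ - ν) P| ≤ ∑ P, (μ P + ν P) := Finset.sum_le_sum fun P _ => by
          rw [Pi.sub_apply]
          exact (abs_sub _ _).trans (by rw [abs_of_nonneg (hμ P), abs_of_nonneg (hν P)])
    _ = 2 := by rw [Finset.sum_add_distrib, hμ1, hν1]; norm_num

/-- The sup distance of two vectors is at most their `ℓ¹` distance. [folklore] -/
theorem dist_le_l1 (μ ν : ColPattern m → ℝ) : dist μ ν ≤ l1 (μ - ν) := by
  refine (dist_pi_le_iff (Finset.sum_nonneg fun P _ => abs_nonneg _)).2 fun P => ?_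
  rw [Real.dist_eq]
  exact Finset.single_le_sum (f := fun P => |(μ - ν) P|) (fun P _ => abs_nonneg _) (Finset.mem_univ P)

end Contraction

/-! ### Two-column periodicity (translation invariance along the strip) -/

section Shift

open MeasureTheory

variable {m : ℕ}

/-- Shifting the column index by `2k` translates the sites by `(k, -k)`. [folklore] -/
theorem colSite_add_two_mul (c k : ℤ) (j : ℕ) : colSite (c + 2 * k) j + ![-k, k] = colSite c j := by
  ext i
  fin_cases i
  · show colSite (c + 2 * k) j 0 + -k = colSite c j 0
    rw [colSite_zero, colSite_zero]; omega
  · show colSite (c + 2 * k) j 1 + k = colSite c j 1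
    rw [colSite_one, colSite_one]; omega

/-- The bare-column pattern depends on the column only through its parity. [folklore] -/
theorem colInit_add_two_mul (c k : ℤ) : colInit m (c + 2 * k) = colInit m c := by
  unfold colInit
  simp only [show (c + 2 * k) % 2 = c % 2 by omega]

/-- The wall contacts depend on the column only through its parity. [folklore] -/
theorem updWall_add_two_mul (c k : ℤ) (P : ColPattern m) : updWall m (c + 2 * k) P = updWall m c P := by
  funext z
  cases z with
  | inl i => rfl
  | inr j => simp only [updWall, show (c + 2 * k + 1) % 2 = (c + 1) % 2 by omega]

/-- The update depends on the column only through its parity. [folklore] -/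
theorem colUpdate_add_two_mul (c k : ℤ) (P : ColPattern m) (E : Fin (m + 1) → Fin (m + 1) → Bool) :
    colUpdate m (c + 2 * k) P E = colUpdate m c P E := by
  unfold colUpdate
  rw [updWall_add_two_mul]

/-- The iterate from a shifted column is the iterate over the shifted layers. [folklore] -/
theorem colIter_add_two_mul (a k : ℤ) (E : ℤ → Fin (m + 1) → Fin (m + 1) → Bool) (n : ℕ) :
    colIter m (a + 2 * k) E n = colIter m a (fun c => E (c + 2 * k)) n := by
  induction n with
  | zero => simp [colIter, colInit_add_two_mul]
  | succ n ih =>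
    simp only [colIter, ih]
    rw [show a + 2 * k + n = (a + n) + 2 * k by ring, colUpdate_add_two_mul]

/-- The edge layer at a shifted column is the edge layer of the shifted configuration. [folklore] -/
theorem colEdges_add_two_mul (ω : BondConfig (Site 2)) (c k : ℤ) :
    colEdges ω m (c + 2 * k) = colEdges (BondConfig.relabel (sym2Equiv (Site.shift ![-k, k])) ω) m c := by
  classical
  funext i j
  simp only [colEdges]
  rw [decide_eq_decide, ← mk_add_mem_relabel_shift_iff ![-k, k] ω (colSite (c + 2 * k) i) (colSite (c + 2 * k + 1) j),
    colSite_add_two_mul, show c + 2 * k + 1 = (c + 1) + 2 * k by ring, colSite_add_two_mul]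

/-- **Two-column periodicity of the iterated laws**: `iterLaw m (a + 2k) n = iterLaw m a n`
(translation invariance of `P_{1/2}` along the strip). [cite: IkhlefPonsaing2012, §3.1] -/
theorem iterLaw_add_two_mul (a k : ℤ) (n : ℕ) : iterLaw m (a + 2 * k) n = iterLaw m a n := by
  funext P
  unfold iterLaw
  have hset : {ω : BondConfig (Site 2) | colIter m (a + 2 * k) (colEdges ω m) n = P} =
      (BondConfig.relabel (sym2Equiv (Site.shift ![-k, k]))) ⁻¹' {ω | colIter m a (colEdges ω m) n = P} := by
    ext ω
    simp only [Set.mem_setOf_eq, Set.mem_preimage]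
    rw [colIter_add_two_mul,
      show (fun c => colEdges ω m (c + 2 * k)) = colEdges (BondConfig.relabel (sym2Equiv (Site.shift ![-k, k])) ω) m from
        funext fun c => colEdges_add_two_mul ω c k]
  rw [hset, bondPercolation_real_preimage_shift]

/-- **Two-column periodicity of the transfer matrix**: `T_{c+2k} = T_c`. [cite: IkhlefPonsaing2012, §3.1] -/
theorem ipTransfer_add_two_mul (c k : ℤ) (P P' : ColPattern m) :
    ipTransfer m (c + 2 * k) P P' = ipTransfer m c P P' := by
  unfold ipTransfer
  have hset : {ω : BondConfig (Site 2) | colUpdate m (c + 2 * k) P (colEdges ω m (c + 2 * k)) = P'} =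
      (BondConfig.relabel (sym2Equiv (Site.shift ![-k, k]))) ⁻¹' {ω | colUpdate m c P (colEdges ω m c) = P'} := by
    ext ω
    simp only [Set.mem_setOf_eq, Set.mem_preimage]
    rw [colUpdate_add_two_mul, colEdges_add_two_mul]
  rw [hset, bondPercolation_real_preimage_shift]

/-- Hence `pushLaw` is `2`-periodic in the column. [folklore] -/
theorem pushLaw_add_two_mul (c k : ℤ) (μ : ColPattern m → ℝ) : pushLaw m (c + 2 * k) μ = pushLaw m c μ := by
  funext P'
  simp only [pushLaw, ipTransfer_add_two_mul]

end Shift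


end Literature.Probability.Percolation
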